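import Summits.QuantumAdvantage.QuantumAdvantage.Theorems.SosSandwichPseudoBoundedAAClassicalCornerSensitivityOSSSAux
import HarnessLib

/-!
# Crux `PseudoBoundedAA` (stmt-QuantumAdvantage-15237, route SosSandwich) — the SENSITIVITY form of the `L²`-OSSS law on
# the classical corner, part 3/3: `16·Var[p]² ≤ (Σ_k w_k·I[t_k]) · (Σⱼ δ̄ⱼ·Infⱼ[p])`

Support file (`--supports stmt-QuantumAdvantage-15237`), sequel of `…ClassicalCornerSensitivityOSSSAux.lean`.

* **`osss_sens`** — the bilinear two-function OSSS inequality for the tree's `DecisionTree` (arbitrary, possibly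
  re-querying trees): with `F` the `0/1` output of `t`, `Σₓ (g(x^{j→1}) − g(x^{j→0}))² ≤ Sⱼ`, any `λ > 0`,
  `2^N Σ F·g − (Σ F)(Σ g) ≤ ⅛·(λ·2^N·Σⱼ Σₓ (F(x^{j→1}) − F(x^{j→0}))² + (Σⱼ #{x : j ∈ t.queries x}·Sⱼ)/λ)`, i.e.
  `Cov[F, g] ≤ ⅛·(λ·I[F] + λ⁻¹·Σⱼ δⱼ(t)·E(g(x^{j→1}) − g(x^{j→0}))²)`;
* **`sixteen_variance_sq_le_avgSensitivity_mul`** — for `p` on the cube a nonnegative mixture `Σ_k w_k [t_k accepts]`: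
  `16·Var[p]² ≤ (Σ_k w_k·I[t_k]) · (Σⱼ δ̄ⱼ·Infⱼ[p])` (`Var = Σ_k w_k Cov([t_k accepts], p)`, `osss_sens` per tree, optimise
  `λ` by `sixteen_sq_le_of_forall_pos`), `I[t_k] = Σⱼ #{x : t_k.eval(x^{j→1}) ≠ t_k.eval(x^{j→0})}/2^N` the total influence
  (average sensitivity) of the Boolean function of `t_k`, `δ̄ⱼ = Σ_k w_k·#{x : j ∈ t_k.queries x}/2^N`.

Reading.  The conjectured `L²`-OSSS law `16 Var² ≤ C₀ Σⱼ δ̄ⱼ Infⱼ` therefore HOLDS with `C₀ := Ī`, the average sensitivity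
of the trees, uniformly in the depth (`Ī ≤ Σⱼ δ̄ⱼ ≤ D̄` by `avgSensitivity_le_sum_queryProb`, so this refines
`sixteen_variance_sq_le_sum_queryProb_mul` and `…_le_avgDepth_mul_…`; for mixtures of low-sensitivity trees, e.g. `AND`s
of `T` literals with `I = T·2^{1−T}`, it is exponentially better); a counterexample family to `L²`-OSSS with an absolute
constant must use trees of unbounded average sensitivity.  The hands' numerics (evidence on the item,
CLASSICAL-CORNER-L2OSSS-SENSITIVITY-15237.md: column generation over adaptive mixtures, the exact family
`R_m = (m+1)²/(m²+m+2)` with maximum `8/7` at depth `2`, `≈ 1.15` at depth `3`, and the linear relaxation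
`sup_f Var[E(f|leaves t)]/Σ_S f̂(S)²δ_t(S) ≈ 0.34·depth + 0.65`) suggest the true constant is small but that no proof can
come from the linear relaxation alone.

Honest label: corner calibration of an open conjecture; no registered stub, crux or summit is closed.
Sources: R. O'Donnell, M. Saks, O. Schramm, R. Servedio, FOCS 2005, Thm 3.2; H. Lee, Theory of Computing 6 (2010);
R. O'Donnell, *Analysis of Boolean Functions* (2014) §8.6; S. Aaronson, A. Ambainis, arXiv:0911.0996, Thm 8 and remark.
-/

set_option linter.dupNamespace false

noncomputable section

namespace Summit.QuantumAdvantage.QuantumAdvantage.Theorems.SosSandwich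

open Finset Function
open Literature.Computability.Complexity Literature.Computability.QuantumComplexity

namespace ClassicalCornerSensitivityOSSS

variable {N : ℕ}

/-! ### The bilinear OSSS inequality, closed form -/

/-- **Bilinear OSSS inequality, two-function form**, for the tree's `DecisionTree` (arbitrary, possibly re-querying
trees): with `F` the `0/1` output of `t`, `Σₓ (g(x^{j→1}) − g(x^{j→0}))² ≤ Sⱼ` and any `λ > 0`,
`2^N Σ F·g − (Σ F)(Σ g) ≤ ⅛·(λ·2^N·Σⱼ Σₓ (F(x^{j→1}) − F(x^{j→0}))² + (Σⱼ #{x : j ∈ t.queries x}·Sⱼ)/λ)`, i.e.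
`Cov[F, g] ≤ ⅛·(λ·I[F] + λ⁻¹·Σⱼ δⱼ(t)·E(g(x^{j→1}) − g(x^{j→0}))²)` with `I[F]` the total influence of `F`.
[cite: OdonnellEtAl2005, Thm 3.2] [cite: ODonnell2014, §8.6] -/
theorem osss_sens (t : DecisionTree N) (F g : (Fin N → Bool) → ℝ) (S : Fin N → ℝ) {lam : ℝ}
    (hF : ∀ x, F x = if t.eval x = true then (1 : ℝ) else 0) (hS : ∀ j, 0 ≤ S j) (hl : 0 < lam)
    (hg : ∀ j : Fin N, ∑ x, (g (update x j true) - g (update x j false)) ^ 2 ≤ S j) :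
    (2 : ℝ) ^ N * (∑ x, F x * g x) - (∑ x, F x) * (∑ x, g x) ≤
      (lam * (2 : ℝ) ^ N * (∑ j, ∑ x, (F (update x j true) - F (update x j false)) ^ 2) +
        (∑ j, ((Finset.univ.filter fun x : Fin N → Bool => j ∈ t.queries x).card : ℝ) * S j) / lam) / 8 := by
  classical
  have key := osss_sens_aux t (fun _ => none) F g S lam (fun x => by rw [hF x]; rfl) hS hl hg
  refine key.trans (le_of_eq ?_)
  congr 3
  refine Finset.sum_congr rfl fun j _ => ?_
  congr 1
  rw [← Finset.sum_boole]
  refine Finset.sum_congr rfl fun x _ => ?_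
  simp only [true_and]
  rfl

/-! ### The classical corner: `16·Var[p]² ≤ Ī · Σⱼ δ̄ⱼ Infⱼ[p]` -/

/-- **The sensitivity form of the `L²`-OSSS law on the classical corner.** If the real polynomial `p` is on the cube a
nonnegative mixture `p(x) = Σ_{k∈s} w_k·[t_k accepts x]` of decision trees, then
`16·Var[p]² ≤ (Σ_k w_k·I[t_k]) · (Σⱼ δ̄ⱼ·Infⱼ[p])`, where `I[t_k] = Σⱼ #{x : t_k(x^{j→1}) ≠ t_k(x^{j→0})}/2^N` is the total
influence (average sensitivity) of the Boolean function computed by `t_k` and `δ̄ⱼ = Σ_k w_k·#{x : j ∈ t_k.queries x}/2^N`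
the mixture's query probabilities.  Since `I[t_k] ≤ Σⱼ δⱼ(t_k) ≤ depth(t_k)` (`avgSensitivity_le_sum_queryProb`), this
refines `16·Var² ≤ (Σⱼ δ̄ⱼ)·(Σⱼ δ̄ⱼ Infⱼ)` and `16·Var² ≤ D̄·Σⱼ δ̄ⱼ Infⱼ`: the conjectured `L²`-OSSS law
`16·Var² ≤ C₀·Σⱼ δ̄ⱼ Infⱼ` holds with `C₀ :=` the average sensitivity of the trees, uniformly in the depth.
[cite: OdonnellEtAl2005, Thm 3.2] [cite: AaronsonAmbainis2014, Thm 8 and the remark following it] -/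
theorem sixteen_variance_sq_le_avgSensitivity_mul {ι : Type*} (s : Finset ι) (w : ι → ℝ)
    (hw : ∀ k ∈ s, 0 ≤ w k) (t : ι → DecisionTree N) (p : MvPolynomial (Fin N) ℝ)
    (hp : ∀ x, evalBool p x = ∑ k ∈ s, w k * (if (t k).eval x = true then (1 : ℝ) else 0)) :
    16 * boolVariance p ^ 2 ≤
      (∑ k ∈ s, w k * ∑ j, (((Finset.univ.filter fun x : Fin N → Bool =>
          (t k).eval (update x j true) ≠ (t k).eval (update x j false)).card : ℝ) / (2 : ℝ) ^ N)) *
      (∑ j, (∑ k ∈ s, w k *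
          (((Finset.univ.filter fun x : Fin N → Bool => j ∈ (t k).queries x).card : ℝ) / (2 : ℝ) ^ N)) *
        influence j p) := by
  classical
  have h2N : (0 : ℝ) < (2 : ℝ) ^ N := by positivity
  set F : ι → (Fin N → Bool) → ℝ := fun k x => if (t k).eval x = true then (1 : ℝ) else 0 with hF
  set g := evalBool p with hgdef
  set S : Fin N → ℝ := fun j => (2 : ℝ) ^ N * influence j p with hSdef
  have hS : ∀ j, 0 ≤ S j := fun j => mul_nonneg h2N.le (influence_nonneg j p)
  have hg : ∀ j : Fin N, ∑ x, (g (update x j true) - g (update x j false)) ^ 2 ≤ S j := fun j =>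
    (BooleanCorner.sum_sq_update_eq_influence p j).le
  -- names for the two factors
  set I : ι → ℝ := fun k => ∑ j, (((Finset.univ.filter fun x : Fin N → Bool =>
      (t k).eval (update x j true) ≠ (t k).eval (update x j false)).card : ℝ) / (2 : ℝ) ^ N) with hI
  set q : ι → Fin N → ℝ := fun k j =>
      ((Finset.univ.filter fun x : Fin N → Bool => j ∈ (t k).queries x).card : ℝ) with hq
  set Ibar : ℝ := ∑ k ∈ s, w k * I k with hIbar
  set D : ℝ := ∑ j, (∑ k ∈ s, w k * (q k j / (2 : ℝ) ^ N)) * influence j p with hD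
  change 16 * boolVariance p ^ 2 ≤ Ibar * D
  -- linearity of the covariance in the first argument
  have hFk : ∀ x, ∑ k ∈ s, w k * F k x = g x := fun x => by rw [hp x]
  have hPg : ∑ x, g x * g x = ∑ k ∈ s, w k * ∑ x, F k x * g x := by
    calc ∑ x, g x * g x = ∑ x, ∑ k ∈ s, w k * (F k x * g x) := by
          refine Finset.sum_congr rfl fun x _ => ?_
          rw [show g x * g x = (∑ k ∈ s, w k * F k x) * g x by rw [hFk x], Finset.sum_mul]
          exact Finset.sum_congr rfl fun k _ => by ring
      _ = ∑ k ∈ s, ∑ x, w k * (F k x * g x) := Finset.sum_comm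
      _ = ∑ k ∈ s, w k * ∑ x, F k x * g x := Finset.sum_congr rfl fun k _ => by rw [Finset.mul_sum]
  have hPs : ∑ x, g x = ∑ k ∈ s, w k * ∑ x, F k x := by
    calc ∑ x, g x = ∑ x, ∑ k ∈ s, w k * F k x := Finset.sum_congr rfl fun x _ => (hFk x).symm
      _ = ∑ k ∈ s, ∑ x, w k * F k x := Finset.sum_comm
      _ = ∑ k ∈ s, w k * ∑ x, F k x := Finset.sum_congr rfl fun k _ => by rw [Finset.mul_sum]
  have hlin : (2 : ℝ) ^ N * (∑ x, g x * g x) - (∑ x, g x) * (∑ x, g x)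
      = ∑ k ∈ s, w k * ((2 : ℝ) ^ N * (∑ x, F k x * g x) - (∑ x, F k x) * (∑ x, g x)) := by
    rw [hPg, show (∑ x, g x) * (∑ x, g x) = (∑ k ∈ s, w k * ∑ x, F k x) * (∑ x, g x) by rw [← hPs],
      Finset.mul_sum, Finset.sum_mul, ← Finset.sum_sub_distrib]
    exact Finset.sum_congr rfl fun k _ => by ring
  have hvar := BooleanCorner.sum_sq_sub_sq_sum_eq p
  rw [← hgdef] at hvar
  -- the sensitivity sums of the trees
  have hA : ∀ k, ∑ j, ∑ x, (F k (update x j true) - F k (update x j false)) ^ 2 = (2 : ℝ) ^ N * I k := by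
    intro k
    rw [hI]
    simp only
    rw [Finset.mul_sum]
    refine Finset.sum_congr rfl fun j _ => ?_
    rw [sum_sq_update_eq_card (t k) (F k) (fun x => rfl) j, mul_div_cancel₀ _ h2N.ne']
  -- the per-`λ` bound
  have hbound : ∀ lam : ℝ, 0 < lam → (2 : ℝ) ^ N * ((2 : ℝ) ^ N * boolVariance p) ≤
      (lam * ((2 : ℝ) ^ N * ((2 : ℝ) ^ N * Ibar)) + ((2 : ℝ) ^ N * ((2 : ℝ) ^ N * D)) / lam) / 8 := by
    intro lam hl
    have h1 : (2 : ℝ) ^ N * ((2 : ℝ) ^ N * boolVariance p) ≤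
        ∑ k ∈ s, w k * ((lam * (2 : ℝ) ^ N * ((2 : ℝ) ^ N * I k) + (∑ j, q k j * S j) / lam) / 8) := by
      rw [← hvar, hlin]
      refine Finset.sum_le_sum fun k hk => mul_le_mul_of_nonneg_left ?_ (hw k hk)
      have := osss_sens (t k) (F k) g S (fun x => rfl) hS hl hg
      rw [hA k] at this
      exact this
    refine h1.trans (le_of_eq ?_)
    -- bookkeeping: `Σ_k w_k (λ 4^N I_k + (Σ_j q_kj S_j)/λ)/8 = (λ 4^N Ibar + 4^N D/λ)/8`
    have hDk : (2 : ℝ) ^ N * ((2 : ℝ) ^ N * D) = ∑ k ∈ s, w k * ∑ j, q k j * S j := by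
      rw [hD, Finset.mul_sum, Finset.mul_sum]
      have hterm : ∀ j, (2 : ℝ) ^ N * ((2 : ℝ) ^ N * ((∑ k ∈ s, w k * (q k j / (2 : ℝ) ^ N)) * influence j p)) =
          ∑ k ∈ s, w k * (q k j * S j) := by
        intro j
        have hS' : S j = (2 : ℝ) ^ N * influence j p := rfl
        rw [Finset.sum_mul, Finset.mul_sum, Finset.mul_sum]
        refine Finset.sum_congr rfl fun k _ => ?_
        rw [hS']
        field_simp
      rw [Finset.sum_congr rfl fun j _ => hterm j, Finset.sum_comm]
      refine Finset.sum_congr rfl fun k _ => ?_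
      rw [Finset.mul_sum]
    rw [hDk, hIbar, Finset.sum_div, Finset.mul_sum, Finset.mul_sum, Finset.mul_sum, ← Finset.sum_add_distrib,
      Finset.sum_div]
    refine Finset.sum_congr rfl fun k _ => ?_
    ring
  have hv : 0 ≤ (2 : ℝ) ^ N * ((2 : ℝ) ^ N * boolVariance p) :=
    mul_nonneg h2N.le (mul_nonneg h2N.le (boolVariance_nonneg p))
  have hIbar0 : 0 ≤ Ibar := Finset.sum_nonneg fun k hk => mul_nonneg (hw k hk)
    (Finset.sum_nonneg fun j _ => by positivity)
  have hD0 : 0 ≤ D := Finset.sum_nonneg fun j _ => mul_nonneg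
    (Finset.sum_nonneg fun k hk => mul_nonneg (hw k hk) (by positivity)) (influence_nonneg j p)
  have ha : 0 ≤ (2 : ℝ) ^ N * ((2 : ℝ) ^ N * Ibar) := by positivity
  have hb : 0 ≤ (2 : ℝ) ^ N * ((2 : ℝ) ^ N * D) := by positivity
  have key := sixteen_sq_le_of_forall_pos hv ha hb hbound
  -- divide by `2^{4N}`
  have h4N : (0 : ℝ) < ((2 : ℝ) ^ N * (2 : ℝ) ^ N) ^ 2 := by positivity
  have key' : ((2 : ℝ) ^ N * (2 : ℝ) ^ N) ^ 2 * (16 * boolVariance p ^ 2) ≤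
      ((2 : ℝ) ^ N * (2 : ℝ) ^ N) ^ 2 * (Ibar * D) := by
    have e1 : 16 * ((2 : ℝ) ^ N * ((2 : ℝ) ^ N * boolVariance p)) ^ 2 =
        ((2 : ℝ) ^ N * (2 : ℝ) ^ N) ^ 2 * (16 * boolVariance p ^ 2) := by ring
    have e2 : (2 : ℝ) ^ N * ((2 : ℝ) ^ N * Ibar) * ((2 : ℝ) ^ N * ((2 : ℝ) ^ N * D)) =
        ((2 : ℝ) ^ N * (2 : ℝ) ^ N) ^ 2 * (Ibar * D) := by ring
    rw [← e1, ← e2]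
    exact key
  exact le_of_mul_le_mul_left key' h4N

end ClassicalCornerSensitivityOSSS

end Summit.QuantumAdvantage.QuantumAdvantage.Theorems.SosSandwich

end
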